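import Mathlib
import HarnessLib
import Summits.MatrixMultiplication.MatrixMultiplication.Theorems.OutsiderSandwichToricCeilingPowSubTwoRules

/-!
# OutsiderSandwich — tight-frame toric ceiling `⟨3^N - 2⟩`, part 3/5: the PURE and CROSSED
slices
(decomp-mm lens 4, gen 45, kernel K45; THESES-FREE, `ω`-free; helper toward `LaserTangency`,
stmt-32268 — the extremal subrank/packing cells of the literal host `kroneckerPow (cwTensor ℂ 2) N`)

LABEL.  TORIC · uniform in `N` · NEC-side instrument; induction steps (part 5 carries the theorem).

WHAT.  Given a diagonal-free perfect matching of `D_m ∖ (X, Y, Z)` for EVERY admissible co-size-2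
triple over `Word m` (the induction hypothesis `ih`), two DISTINCT such matchings over
`Word (m+1)` when the pivot coordinate `p` carries a doubled pair:
* `twoPM_pure` — `x₁ₚ = x₂ₚ = a`, `y₁ₚ = y₂ₚ = a + d` (then `z₁ₚ = z₂ₚ = a + 2d`): the slot
  `(a, a+d, a+2d)` carries the tail instance, the two other slots are full layers matched by a
  parallel class `δ`; `δ = 1, 2` give two matchings (`glue_inj`, `par_one_ne_two`).
* `crossed_core` / `twoPM_crossedX` — `x₁ₚ = x₂ₚ = a`, `{y₁ₚ, y₂ₚ} = {z₁ₚ, z₂ₚ} = {b, c}`: primary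
  direction `d = b - a`; slot `a` carries the co-size-2 tail instance
  `({x₁', x₂'}, {y_b', B₁}, {z_c', C₂})` (induction), slots `b`, `c` carry stars, plus two auxiliary
  triples in the slots `(c, b, a)`, `(b, a, c)` with tails from the flip rule (part 2, `cr_spec`);
  every triple over the `A`-layer `a` has `B`-letter `b`.  The MIRROR construction (`b ↔ c`) has
  `B`-letter `c` there, so the two matchings differ (a vertex `(a, u)` with `u ∉ {x₁', x₂'}` exists
  as `3^m ≥ 3`).
-/

set_option linter.dupNamespace false

namespace Summit.MatrixMultiplication.MatrixMultiplication.Theorems.OutsiderSandwichToricCeilingPowSubTwoCrossed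

open Finset
open Summit.MatrixMultiplication.MatrixMultiplication.Theorems.OutsiderSandwichToricCeiling (dSlot)
open Summit.MatrixMultiplication.MatrixMultiplication.Theorems.OutsiderSandwichToricCeilingPowFibres
  (Word Tr3 slotB frame)
open Summit.MatrixMultiplication.MatrixMultiplication.Theorems.OutsiderSandwichToricCeilingPowSubTwoGlue
open Summit.MatrixMultiplication.MatrixMultiplication.Theorems.OutsiderSandwichToricCeilingPowSubTwoRules

variable {m : ℕ}

/-! ## §6a The PURE and CROSSED slices -/

/-- PURE SLICE: all three pairs doubled at the pivot (`x`'s in layer `a`, `y`'s in `a + d`,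
`z`'s in `a + 2d`).  Glue the induction matching in the slot `(a, a+d, a+2d)` with parallel classes
in the two other slots; the two parallel classes of one full slot give two matchings. -/
theorem twoPM_pure (ih : ∀ x₁ x₂ y₁ y₂ z₁ z₂ : Word m, x₁ ≠ x₂ → y₁ ≠ y₂ → z₁ ≠ z₂ →
      (∀ i, twice (x₁ i) (x₂ i) (y₁ i) (y₂ i) (z₁ i) (z₂ i) = true) →
      ∃ P, isPM P {x₁, x₂} {y₁, y₂} {z₁, z₂} = true)
    (hm : 1 ≤ m) {p : Fin (m + 1)} {x₁ x₂ y₁ y₂ z₁ z₂ : Word (m + 1)}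
    (hx : x₁ ≠ x₂) (hy : y₁ ≠ y₂) (hz : z₁ ≠ z₂)
    (hadm : ∀ i, twice (x₁ i) (x₂ i) (y₁ i) (y₂ i) (z₁ i) (z₂ i) = true)
    (hxp : x₁ p = x₂ p) (hyp : y₁ p = y₂ p) :
    ∃ P₁ P₂, P₁ ≠ P₂ ∧ isPM P₁ {x₁, x₂} {y₁, y₂} {z₁, z₂} = true ∧
      isPM P₂ {x₁, x₂} {y₁, y₂} {z₁, z₂} = true := by
  obtain ⟨hd, hy₁, hz₁, hz₂⟩ := pure_letters _ _ _ _ _ _ (hadm p) hxp hyp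
  generalize ha : x₁ p = a at hd hy₁ hz₁ hz₂ hxp
  generalize hdd : y₁ p - a = d at hd hy₁ hz₁ hz₂
  have hX2 : x₂ p = a := hxp.symm
  have hY2 : y₂ p = a + d := hyp ▸ hy₁
  obtain ⟨n₁, n₂, n₃⟩ := F3.lift_ne a d hd
  obtain ⟨Qa, hQa⟩ := ih (tl p x₁) (tl p x₂) (tl p y₁) (tl p y₂) (tl p z₁) (tl p z₂)
    (tl_ne hx (ha.trans hX2.symm)) (tl_ne hy hyp) (tl_ne hz (hz₁.trans hz₂.symm)) (fun j => hadm _)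
  have build : ∀ δ : Fin 3, δ ≠ 0 → isPM (glue p d ∅ fun a' => if a' = a then Qa else
      univ.image (tr fun _ => δ)) {x₁, x₂} {y₁, y₂} {z₁, z₂} = true := by
    intro δ hδ
    refine isPM_glue hd (by simp) (by simp) (by simp) (by simp) (by simp) (by simp) (by simp) ?_
    intro a'
    by_cases ha' : a' = a
    · subst ha'
      have e1 : layer p a' ({x₁, x₂} ∪ (∅ : Finset (Tr3 (m + 1))).image (fun t => t.1)) =
          {tl p x₁, tl p x₂} := by
        ext u; simp [ins_eq_iff, ha, hX2]
      have e2 : layer p (a' + d) ({y₁, y₂} ∪ (∅ : Finset (Tr3 (m + 1))).image (fun t => t.2.1)) =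
          {tl p y₁, tl p y₂} := by
        ext u; simp [ins_eq_iff, hy₁, hY2]
      have e3 : layer p (a' + d + d) ({z₁, z₂} ∪ (∅ : Finset (Tr3 (m + 1))).image (fun t => t.2.2))
          = {tl p z₁, tl p z₂} := by
        ext u; simp [ins_eq_iff, hz₁, hz₂]
      rw [e1, e2, e3, if_pos rfl]
      exact hQa
    · have e1 : layer p a' ({x₁, x₂} ∪ (∅ : Finset (Tr3 (m + 1))).image (fun t => t.1)) = ∅ := by
        ext u; simp [ins_eq_iff, ha, hX2, ha']
      have e2 : layer p (a' + d) ({y₁, y₂} ∪ (∅ : Finset (Tr3 (m + 1))).image (fun t => t.2.1))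
          = ∅ := by
        ext u; simp [ins_eq_iff, hy₁, hY2, ha']
      have e3 : layer p (a' + d + d) ({z₁, z₂} ∪ (∅ : Finset (Tr3 (m + 1))).image (fun t => t.2.2))
          = ∅ := by
        ext u; simp [ins_eq_iff, hz₁, hz₂, ha']
      rw [e1, e2, e3, if_neg ha']
      exact isPM_par δ hδ
  refine ⟨_, _, fun e => ?_, build 1 (by decide), build 2 (by decide)⟩
  have h := (glue_inj hd (by simp) (by simp) e).2 (a + 1)
  simp only [if_neg (F3.add_one_ne a)] at h
  exact par_one_ne_two hm h

/-- CROSSED CORE: `x₁, x₂` in layer `a`; `y_b, z_b` in layer `a + d`; `y_c, z_c` in layer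
`a + 2d`.  Primary direction `d`: slot `a` carries the co-size-2 instance
`({x₁', x₂'}, {y_b', B₁}, {z_c', C₂})` (induction), slots `a + d`, `a + 2d` carry stars, and the two
auxiliary triples `T° ∈ (a+2d, a+d, a)`, `T°° ∈ (a+d, a, a+2d)` have tails given by the flip rule.
Every triple of the matching with `A`-letter `a` has `B`-letter `a + d`. -/
theorem crossed_core (ih : ∀ x₁ x₂ y₁ y₂ z₁ z₂ : Word m, x₁ ≠ x₂ → y₁ ≠ y₂ → z₁ ≠ z₂ →
      (∀ i, twice (x₁ i) (x₂ i) (y₁ i) (y₂ i) (z₁ i) (z₂ i) = true) →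
      ∃ P, isPM P {x₁, x₂} {y₁, y₂} {z₁, z₂} = true)
    (hm : 1 ≤ m) {p : Fin (m + 1)} {a d : Fin 3} (hd : d ≠ 0)
    {x₁ x₂ yb yc zb zc : Word (m + 1)} (hx : x₁ ≠ x₂)
    (hX1 : x₁ p = a) (hX2 : x₂ p = a) (hYb : yb p = a + d) (hYc : yc p = a + d + d)
    (hZb : zb p = a + d) (hZc : zc p = a + d + d)
    (hadm : ∀ i, twice (x₁ i) (x₂ i) (yb i) (yc i) (zb i) (zc i) = true) :
    ∃ P, isPM P {x₁, x₂} {yb, yc} {zb, zc} = true ∧ ∀ t ∈ P, t.1 p = a → t.2.1 p = a + d := by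
  obtain ⟨n₁, n₂, n₃⟩ := F3.lift_ne a d hd
  have h3 : a + d + d + d = a := F3.add3 a d
  have H := fun j => cr_spec (x₁ (p.succAbove j)) (x₂ (p.succAbove j)) (yb (p.succAbove j))
    (yc (p.succAbove j)) (zb (p.succAbove j)) (zc (p.succAbove j)) (hadm _)
  -- tails of the auxiliary triples
  obtain ⟨A₁, hA₁⟩ : ∃ A₁ : Word m, A₁ = fun j =>
    crA₁ (yb (p.succAbove j)) (yc (p.succAbove j)) (zb (p.succAbove j)) (zc (p.succAbove j)) :=
    ⟨_, rfl⟩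
  obtain ⟨B₁, hB₁⟩ : ∃ B₁ : Word m, B₁ = fun j =>
    crB₁ (yb (p.succAbove j)) (yc (p.succAbove j)) (zb (p.succAbove j)) (zc (p.succAbove j)) :=
    ⟨_, rfl⟩
  obtain ⟨C₁, hC₁⟩ : ∃ C₁ : Word m, C₁ = fun j =>
    crC₁ (yb (p.succAbove j)) (yc (p.succAbove j)) (zb (p.succAbove j)) (zc (p.succAbove j)) :=
    ⟨_, rfl⟩
  obtain ⟨A₂, hA₂⟩ : ∃ A₂ : Word m, A₂ = fun j =>
    crA₂ (yb (p.succAbove j)) (yc (p.succAbove j)) (zb (p.succAbove j)) (zc (p.succAbove j)) :=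
    ⟨_, rfl⟩
  obtain ⟨B₂, hB₂⟩ : ∃ B₂ : Word m, B₂ = fun j =>
    crB₂ (yb (p.succAbove j)) (yc (p.succAbove j)) (zb (p.succAbove j)) (zc (p.succAbove j)) :=
    ⟨_, rfl⟩
  obtain ⟨C₂, hC₂⟩ : ∃ C₂ : Word m, C₂ = fun j =>
    crC₂ (yb (p.succAbove j)) (yc (p.succAbove j)) (zb (p.succAbove j)) (zc (p.succAbove j)) :=
    ⟨_, rfl⟩
  have F1 : ∀ j, A₁ j ≠ B₁ j ∧ B₁ j ≠ C₁ j ∧ A₁ j ≠ C₁ j := fun j => by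
    rw [hA₁, hB₁, hC₁]; exact (H j).1
  have F2 : ∀ j, A₂ j ≠ B₂ j ∧ B₂ j ≠ C₂ j ∧ A₂ j ≠ C₂ j := fun j => by
    rw [hA₂, hB₂, hC₂]; exact (H j).2.1
  have F3s : ∀ j, A₂ j ≠ tl p yc j ∧ tl p yc j ≠ C₁ j ∧ A₂ j ≠ C₁ j := fun j => by
    rw [hA₂, hC₁]; exact (H j).2.2.1
  have F4 : ∀ j, A₁ j ≠ B₂ j ∧ B₂ j ≠ tl p zb j ∧ A₁ j ≠ tl p zb j := fun j => by
    rw [hA₁, hB₂]; exact (H j).2.2.2.1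
  have F5 : ∀ j, twice (tl p x₁ j) (tl p x₂ j) (tl p yb j) (B₁ j) (tl p zc j) (C₂ j) = true :=
    fun j => by rw [hB₁, hC₂]; exact (H j).2.2.2.2.1
  have F6 : tl p yb ≠ B₁ := fun e => (H ⟨0, hm⟩).2.2.2.2.2.1 (by
    have h := congrFun e ⟨0, hm⟩; rw [hB₁] at h; exact h.symm)
  have F7 : tl p zc ≠ C₂ := fun e => (H ⟨0, hm⟩).2.2.2.2.2.2 (by
    have h := congrFun e ⟨0, hm⟩; rw [hC₂] at h; exact h.symm)
  -- the three sub-matchings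
  obtain ⟨Qa, hQa⟩ := ih (tl p x₁) (tl p x₂) (tl p yb) B₁ (tl p zc) C₂
    (tl_ne hx (hX1.trans hX2.symm)) F6 F7 F5
  have hQb := isPM_star A₂ (tl p yc) C₁ F3s
  have hQc := isPM_star A₁ B₂ (tl p zb) F4
  -- the auxiliary triples
  obtain ⟨T₁, hT₁⟩ : ∃ T₁ : Tr3 (m + 1), T₁ = (ins p (a + d + d) A₁, ins p (a + d) B₁, ins p a C₁) :=
    ⟨_, rfl⟩
  obtain ⟨T₂, hT₂⟩ : ∃ T₂ : Tr3 (m + 1), T₂ = (ins p (a + d) A₂, ins p a B₂, ins p (a + d + d) C₂) :=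
    ⟨_, rfl⟩
  refine ⟨glue p d {T₁, T₂} fun a' => if a' = a then Qa else if a' = a + d then
      (univ.erase A₂).image (tr (tl p yc - A₂)) else (univ.erase A₁).image (tr (B₂ - A₁)), ?_, ?_⟩
  · refine isPM_glue hd ?_ ?_ ?_ ?_ ?_ ?_ ?_ ?_
    · intro t ht
      simp only [mem_insert, mem_singleton] at ht
      rcases ht with rfl | rfl
      · rw [hT₁]; exact mk3_mem_tfr.2 ⟨⟨n₂.symm, n₁.symm, n₃.symm⟩, F1⟩
      · rw [hT₂]; exact mk3_mem_tfr.2 ⟨⟨n₁.symm, n₃, n₂⟩, F2⟩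
    · exact injOn_pair fun e => by
        rw [hT₁, hT₂] at e; simp only [ins_inj] at e; exact absurd e.1 n₂.symm
    · exact injOn_pair fun e => by
        rw [hT₁, hT₂] at e; simp only [ins_inj] at e; exact absurd e.1 n₁.symm
    · exact injOn_pair fun e => by
        rw [hT₁, hT₂] at e; simp only [ins_inj] at e; exact absurd e.1 n₃
    · intro t ht
      simp only [mem_insert, mem_singleton] at ht
      rcases ht with rfl | rfl
      · rw [hT₁]; simp [ins_eq_iff, hX1, hX2, n₃.symm]
      · rw [hT₂]; simp [ins_eq_iff, hX1, hX2, n₁.symm]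
    · intro t ht
      simp only [mem_insert, mem_singleton] at ht
      rcases ht with rfl | rfl
      · rw [hT₁]; simp [ins_eq_iff, hYb, hYc, F6.symm, n₂]
      · rw [hT₂]; simp [ins_eq_iff, hYb, hYc, n₁, n₃]
    · intro t ht
      simp only [mem_insert, mem_singleton] at ht
      rcases ht with rfl | rfl
      · rw [hT₁]; simp [ins_eq_iff, hZb, hZc, n₁, n₃]
      · rw [hT₂]; simp [ins_eq_iff, hZb, hZc, F7.symm, n₂.symm]
    · intro a'
      rcases F3.cases3 a d a' hd with rfl | rfl | rfl
      · have e1 : layer p a' ({x₁, x₂} ∪ ({T₁, T₂} : Finset (Tr3 (m + 1))).image (fun t => t.1))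
            = {tl p x₁, tl p x₂} := by
          ext u; simp [hT₁, hT₂, ins_eq_iff, hX1, hX2, n₁, n₃]
        have e2 : layer p (a' + d) ({yb, yc} ∪ ({T₁, T₂} : Finset (Tr3 (m + 1))).image
            (fun t => t.2.1)) = {tl p yb, B₁} := by
          ext u; simp [hT₁, hT₂, ins_eq_iff, hYb, hYc, n₂, n₁.symm]; exact or_comm
        have e3 : layer p (a' + d + d) ({zb, zc} ∪ ({T₁, T₂} : Finset (Tr3 (m + 1))).image
            (fun t => t.2.2)) = {tl p zc, C₂} := by
          ext u; simp [hT₁, hT₂, ins_eq_iff, hZb, hZc, n₂.symm, n₃.symm]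
        rw [e1, e2, e3, if_pos rfl]
        exact hQa
      · have e1 : layer p (a + d) ({x₁, x₂} ∪ ({T₁, T₂} : Finset (Tr3 (m + 1))).image
            (fun t => t.1)) = {A₂} := by
          ext u; simp [hT₁, hT₂, ins_eq_iff, hX1, hX2, n₂, n₁.symm]
        have e2 : layer p (a + d + d) ({yb, yc} ∪ ({T₁, T₂} : Finset (Tr3 (m + 1))).image
            (fun t => t.2.1)) = {tl p yc} := by
          ext u; simp [hT₁, hT₂, ins_eq_iff, hYb, hYc, n₂.symm, n₃.symm]
        have e3 : layer p (a + d + d + d) ({zb, zc} ∪ ({T₁, T₂} : Finset (Tr3 (m + 1))).image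
            (fun t => t.2.2)) = {C₁} := by
          ext u; simp [hT₁, hT₂, ins_eq_iff, hZb, hZc, h3, n₁, n₃]
        rw [e1, e2, e3, if_neg n₁.symm, if_pos rfl]
        exact hQb
      · have e1 : layer p (a + d + d) ({x₁, x₂} ∪ ({T₁, T₂} : Finset (Tr3 (m + 1))).image
            (fun t => t.1)) = {A₁} := by
          ext u; simp [hT₁, hT₂, ins_eq_iff, hX1, hX2, n₂.symm, n₃.symm]
        have e2 : layer p (a + d + d + d) ({yb, yc} ∪ ({T₁, T₂} : Finset (Tr3 (m + 1))).image
            (fun t => t.2.1)) = {B₂} := by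
          ext u; simp [hT₁, hT₂, ins_eq_iff, hYb, hYc, h3, n₁, n₃]
        have e3 : layer p (a + d + d + d + d) ({zb, zc} ∪ ({T₁, T₂} : Finset (Tr3 (m + 1))).image
            (fun t => t.2.2)) = {tl p zb} := by
          ext u; simp [hT₁, hT₂, ins_eq_iff, hZb, hZc, h3, n₂, n₁.symm]
        rw [e1, e2, e3, if_neg n₃.symm, if_neg n₂.symm]
        exact hQc
  · intro t ht hta
    by_cases hA : t ∈ ({T₁, T₂} : Finset (Tr3 (m + 1)))
    · simp only [mem_insert, mem_singleton] at hA
      rcases hA with rfl | rfl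
      · rw [hT₁] at hta; simp [n₃.symm] at hta
      · rw [hT₂] at hta; simp [n₁.symm] at hta
    · rw [glue_dir ht hA, hta]

/-- CROSSED SLICE, `x`-form: two matchings from the core construction and its MIRROR (primary
direction `-d`): over the `A`-layer `a` their `B`-letters differ. -/
theorem twoPM_crossedX (ih : ∀ x₁ x₂ y₁ y₂ z₁ z₂ : Word m, x₁ ≠ x₂ → y₁ ≠ y₂ → z₁ ≠ z₂ →
      (∀ i, twice (x₁ i) (x₂ i) (y₁ i) (y₂ i) (z₁ i) (z₂ i) = true) →
      ∃ P, isPM P {x₁, x₂} {y₁, y₂} {z₁, z₂} = true)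
    (hm : 1 ≤ m) {p : Fin (m + 1)} {x₁ x₂ y₁ y₂ z₁ z₂ : Word (m + 1)}
    (hx : x₁ ≠ x₂) (hadm : ∀ i, twice (x₁ i) (x₂ i) (y₁ i) (y₂ i) (z₁ i) (z₂ i) = true)
    (hxp : x₁ p = x₂ p) (hyp : y₁ p ≠ y₂ p) :
    ∃ P₁ P₂, P₁ ≠ P₂ ∧ isPM P₁ {x₁, x₂} {y₁, y₂} {z₁, z₂} = true ∧
      isPM P₂ {x₁, x₂} {y₁, y₂} {z₁, z₂} = true := by
  obtain ⟨⟨hxy₁, hxy₂⟩, hz⟩ := crossed_letters _ _ _ _ _ _ (hadm p) hxp hyp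
  -- the case `z₁ ~ y₁` (the other case by swapping `z₁, z₂`)
  have key : ∀ {z₁ z₂ : Word (m + 1)},
      (∀ i, twice (x₁ i) (x₂ i) (y₁ i) (y₂ i) (z₁ i) (z₂ i) = true) → z₁ p = y₁ p → z₂ p = y₂ p →
      ∃ P₁ P₂, P₁ ≠ P₂ ∧ isPM P₁ {x₁, x₂} {y₁, y₂} {z₁, z₂} = true ∧
        isPM P₂ {x₁, x₂} {y₁, y₂} {z₁, z₂} = true := by
    intro z₁ z₂ hadm hz₁ hz₂
    obtain ⟨hd, hb, hc, -, -⟩ := F3.third (x₁ p) (y₁ p) (y₂ p) hxy₁ hyp hxy₂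
    obtain ⟨hd', hb', hc', -, -⟩ := F3.third (x₁ p) (y₂ p) (y₁ p) hxy₂ (Ne.symm hyp) hxy₁
    obtain ⟨P₁, h₁, dir₁⟩ := crossed_core ih hm hd hx rfl hxp.symm hb.symm hc.symm
      (hz₁.trans hb.symm) (hz₂.trans hc.symm) hadm
    obtain ⟨P₂, h₂, dir₂⟩ := crossed_core ih hm hd' hx rfl hxp.symm hb'.symm hc'.symm
      (hz₂.trans hb'.symm) (hz₁.trans hc'.symm)
      (fun i => twice_swap_z _ _ _ _ _ _ (twice_swap_y _ _ _ _ _ _ (hadm i)))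
    rw [pair_comm y₂ y₁, pair_comm z₂ z₁] at h₂
    refine ⟨P₁, P₂, fun e => ?_, h₁, h₂⟩
    obtain ⟨u, hu₁, hu₂⟩ := exists_not_pair hm (tl p x₁) (tl p x₂)
    have hw : ins p (x₁ p) u ∈ P₁.image (fun t => t.1) := by
      rw [(isPM_iff.1 h₁).2.2.2.2.1, mem_sdiff]
      refine ⟨mem_univ _, ?_⟩
      simp [ins_eq_iff, hxp, hu₁, hu₂]
    rw [mem_image] at hw
    obtain ⟨t, ht, htw⟩ := hw
    have hta : t.1 p = x₁ p := by rw [htw, ins_apply_same]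
    have e₁ := dir₁ t ht hta
    have e₂ := dir₂ t (e ▸ ht) hta
    rw [hb] at e₁; rw [hb'] at e₂
    exact hyp (e₁.symm.trans e₂)
  rcases hz with ⟨hz₁, hz₂⟩ | ⟨hz₁, hz₂⟩
  · exact key hadm hz₁ hz₂
  · obtain ⟨P₁, P₂, hne, h₁, h₂⟩ :=
      key (fun i => twice_swap_z _ _ _ _ _ _ (hadm i)) hz₂ hz₁
    rw [pair_comm z₂ z₁] at h₁ h₂
    exact ⟨P₁, P₂, hne, h₁, h₂⟩

end Summit.MatrixMultiplication.MatrixMultiplication.Theorems.OutsiderSandwichToricCeilingPowSubTwoCrossed
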